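import Literature.NumberTheory.GaloisRepresentations.GaloisSubgroups
import Literature.NumberTheory.GaloisRepresentations.KummerGalFixing
import Literature.NumberTheory.GaloisCohomology.CyclotomicKillingPrimePower
import Literature.NumberTheory.EllipticCurves.ZpExtensionLayerCharacter
import Mathlib.FieldTheory.Galois.Abelian
import Mathlib.NumberTheory.NumberField.Basic
import HarnessLib

/-!
# Crux `PrintCf2.SplitBadTwoRankOneOfFacts` (stmt-BirchSwinnertonDyer-20368), skeleton v13.4, registered stub `stub_xRegular_two` = (REG₂), FACT-FREE
# road, θ-BOOKKEEPING glue: THE TWISTED LAYER FIELD `F′ = F·K_{θ₀}` — existence inside `K̄` with `Gal(K̄/F′) = Gal(K̄/F) ∩ ker ε`,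
# finite, ABELIAN over `K`, a number field (the field the twisted (PRO-NULL)_U theorems p704411 / p705557 quantify over)

Cell `bsd-print-cf2`, EXTRA WIDTH seat `bsd-line-cf2-p1-w4` g14 (prover-bsd-line-cf2-p1-w4-g14-0); `--supports stmt-BirchSwinnertonDyer-20368`
(helper, Theses-free, Summits-import-free). HONEST FRAMING: nothing here closes the crux or a registered stub; BSD is not proved by any of
this; no summit statement is proved by this seat. No definition, no named fact, no `sorry`. Pure Galois-theory plumbing.

WHY. The class-level twisted (PRO-NULL)_U theorems (-w3 g13 p704411 `KummerU.exists_level_resH1Hom_eq_zero_of_local_twisted`, this seat's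
p705557 `KummerUDict.…_ramified`) take TWO intermediate fields `F ⊆ F′ ⊆ K̄` with `[FiniteDimensional K F′] [IsAbelianGalois K F′]
[NumberField F′] [(galFixing K F).Normal] [(galFixing K F′).Normal]` and the three inclusions `galFixing K F′ ≤ galFixing K F`,
`ε = 1 on galFixing K F′`, `{u ∈ galFixing K F : ε u = 1} ⊆ galFixing K F′` — i.e. `Gal(K̄/F′) = Gal(K̄/F) ∩ ker ε`. In the (LSₙ,₂) level
assembly `F = K*_n = κ₂.layer n` and `ε` is the sign character of the quadratic `θ₀`; the field `F′` has to be PRODUCED, with its instances.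
THIS FILE produces it:
* §1 **`exists_intermediateField_galFixing_eq_inf_ker`** — `K` a number field, `F ⊆ K̄` finite ABELIAN Galois over `K`, `ε : Γ_K →* ℤˣ` with
  OPEN kernel ⟹ `∃ F′ : IntermediateField K K̄, galFixing K F′ = galFixing K F ⊓ ε.ker ∧ F ≤ F′ ∧ FiniteDimensional K F′ ∧
  IsAbelianGalois K F′ ∧ NumberField F′ ∧ (galFixing K F′).Normal` (Krull: the closed subgroup `Gal(K̄/F) ∩ ker ε` is a `galFixing`
  (`KummerGalFixing.exists_eq_galFixing_of_isClosed`); it is open ⟹ finite (`InfiniteGalois.isOpen_iff_finite`); normal ⟹ Galois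
  (`InfiniteGalois.normal_iff_isGalois`); `Gal(F′/K)` is commutative because every commutator of `Γ_K` dies in `Gal(F/K)` (abelian) and in
  `ℤˣ`, hence lies in `Gal(K̄/F′) = ker (resGal F′)`); the three inclusion slots `galFixing_inf_ker_le`, `apply_eq_one_of_mem_galFixing_inf_ker`,
  `mem_galFixing_inf_ker_of_apply_eq_one` read them off the equation;
* §2 **`exists_twistedLayerField`** — the instance for the `ℤ_p`-layers: `F = κ.layer n` (`galFixing K (κ.layer n) = κ.layerSubgroup n`,
  `GaloisCohomology.galFixing_layer`): `∃ F′, galFixing K F′ = κ.layerSubgroup n ⊓ ε.ker ∧ κ.layer n ≤ F′ ∧ …`.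
NOT here: the sign character `ε` of a framed quadratic `θ` (tree: -w2 g14 `XRegPinned.exists_signChar` / `TwistSign`), the level modules.
presearch: Krull correspondence / compositum of abelian extensions is abelian — folklore (Neukirch IV §1, Milne FT Ch. 7); tree: `GaloisSubgroups`,
`KummerGalFixing`, `isAbelianGalois_sup`; no new fact. beyond-print theorem: no.

References: [NeukirchANT1999] Ch. IV §1; [MilneFT2022] Ch. 7 (Thm. 7.12, Krull); [Washington1997] §13.1.
-/

noncomputable section

set_option linter.dupNamespace false
set_option autoImplicit false

open scoped Classical
open NumberField Field IntermediateField
open Literature.NumberTheory.GaloisRepresentations Literature.NumberTheory.GaloisRepresentations.LocalWeilDatum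

namespace Summit.BirchSwinnertonDyer.BirchSwinnertonDyer.Theorems.PrintCf2.KummerUDict

universe u

/-! ## §1. The fixed field of `Gal(K̄/F) ∩ ker ε` -/

section General

variable {K : Type u} [Field K]

/-- The three inclusion slots of the twisted (PRO-NULL)_U theorems, read off `galFixing K F′ = galFixing K F ⊓ ε.ker` (1/3):
`Gal(K̄/F′) ≤ Gal(K̄/F)`. [folklore] -/
theorem galFixing_inf_ker_le {F F' : IntermediateField K (AlgebraicClosure K)} {ε : absoluteGaloisGroup K →* ℤˣ}
    (h : galFixing K F' = galFixing K F ⊓ ε.ker) : galFixing K F' ≤ galFixing K F :=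
  h ▸ inf_le_left

/-- (2/3): `ε = 1` on `Gal(K̄/F′)`. [folklore] -/
theorem apply_eq_one_of_mem_galFixing_inf_ker {F F' : IntermediateField K (AlgebraicClosure K)} {ε : absoluteGaloisGroup K →* ℤˣ}
    (h : galFixing K F' = galFixing K F ⊓ ε.ker) : ∀ u ∈ galFixing K F', ε u = 1 := fun u hu ↦ by
  rw [h] at hu
  exact (MonoidHom.mem_ker).1 (Subgroup.mem_inf.1 hu).2

/-- (3/3): an element of `Gal(K̄/F)` on which `ε = 1` lies in `Gal(K̄/F′)`. [folklore] -/
theorem mem_galFixing_inf_ker_of_apply_eq_one {F F' : IntermediateField K (AlgebraicClosure K)} {ε : absoluteGaloisGroup K →* ℤˣ}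
    (h : galFixing K F' = galFixing K F ⊓ ε.ker) : ∀ u ∈ galFixing K F, ε u = 1 → u ∈ galFixing K F' := fun u hu hεu ↦ by
  rw [h]
  exact Subgroup.mem_inf.2 ⟨hu, (MonoidHom.mem_ker).2 hεu⟩

/-- A commutator of `Γ_K` dies under a homomorphism to `ℤˣ`. [folklore] -/
theorem sign_commutator_eq_one (ε : absoluteGaloisGroup K →* ℤˣ) (σ τ : absoluteGaloisGroup K) : ε (σ * τ * σ⁻¹ * τ⁻¹) = 1 := by
  rw [map_mul, map_mul, map_mul, map_inv, map_inv, mul_inv_eq_one, mul_inv_eq_iff_eq_mul, mul_comm]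

/-- A commutator of `Γ_K` dies in `Gal(K̄/F)` when `F/K` is (normal and) ABELIAN: its restriction to `F` is a commutator of the commutative
group `Gal(F/K)` (`resGal`, kernel `galFixing K F`). [cite: NeukirchANT1999, Ch. IV §1] -/
theorem commutator_mem_galFixing (F : IntermediateField K (AlgebraicClosure K)) [IsAbelianGalois K F] (σ τ : absoluteGaloisGroup K) :
    σ * τ * σ⁻¹ * τ⁻¹ ∈ galFixing K F := by
  haveI : Normal K F := inferInstance
  rw [← ker_resGal F, MonoidHom.mem_ker, map_mul, map_mul, map_mul, map_inv, map_inv, mul_inv_eq_one, mul_inv_eq_iff_eq_mul]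
  exact IsMulCommutative.is_comm.comm _ _

variable [NumberField K]

/-- **THE TWISTED LAYER FIELD.** For a number field `K`, a finite ABELIAN Galois subextension `F ⊆ K̄` and a homomorphism `ε : Γ_K →* ℤˣ`
with OPEN kernel, there is `F′ ⊆ K̄` with `Gal(K̄/F′) = Gal(K̄/F) ∩ ker ε`, and `F ⊆ F′`, `F′/K` finite ABELIAN Galois, `F′` a number field,
`Gal(K̄/F′) ⊴ Γ_K`. (`F′ = F·K_ε`; Krull correspondence.) [cite: NeukirchANT1999, Ch. IV §1] [cite: MilneFT2022, Ch. 7, Thm. 7.12 (Krull)] -/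
theorem exists_intermediateField_galFixing_eq_inf_ker (F : IntermediateField K (AlgebraicClosure K)) [FiniteDimensional K F]
    [IsAbelianGalois K F] (ε : absoluteGaloisGroup K →* ℤˣ) (hε : IsOpen (ε.ker : Set (absoluteGaloisGroup K))) :
    ∃ F' : IntermediateField K (AlgebraicClosure K),
      galFixing K F' = galFixing K F ⊓ ε.ker ∧ F ≤ F' ∧ FiniteDimensional K F' ∧ IsAbelianGalois K F' ∧ NumberField F' ∧
        (galFixing K F').Normal := by
  haveI : IsGalois K (AlgebraicClosure K) := ⟨⟩
  haveI : Normal K F := inferInstance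
  set H : Subgroup (absoluteGaloisGroup K) := galFixing K F ⊓ ε.ker with hH
  -- `H` is open and closed, normal
  have hHopen : IsOpen (H : Set (absoluteGaloisGroup K)) := (isOpen_galFixing K F).inter hε
  have hHclosed : IsClosed (H : Set (absoluteGaloisGroup K)) := (isClosed_galFixing K F).inter (Subgroup.isClosed_of_isOpen _ hε)
  haveI hFnormal : (galFixing K F).Normal := normal_galFixing F
  haveI hHnormal : H.Normal := inferInstance
  -- Krull: `H = Gal(K̄/F′)`
  obtain ⟨F', hF'⟩ := exists_eq_galFixing_of_isClosed H hHclosed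
  -- finite
  haveI hfin : FiniteDimensional K F' := (InfiniteGalois.isOpen_iff_finite F').mp (by
    have h1 : IsOpen (galFixing K F' : Set (absoluteGaloisGroup K)) := hF' ▸ hHopen
    exact h1)
  -- Galois
  have hF'normal : (galFixing K F').Normal := hF' ▸ hHnormal
  haveI hgal : IsGalois K F' := (InfiniteGalois.normal_iff_isGalois F').mp (by exact hF'normal)
  haveI : Normal K F' := inferInstance
  -- abelian: commutators of `Γ_K` lie in `H = ker (resGal F′)`
  have hcomm : ∀ x y : (F' ≃ₐ[K] F'), x * y = y * x := by
    intro x y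
    obtain ⟨σ, rfl⟩ := resGal_surjective F' x
    obtain ⟨τ, rfl⟩ := resGal_surjective F' y
    have hmem : σ * τ * σ⁻¹ * τ⁻¹ ∈ (resGal F').ker := by
      rw [ker_resGal, hF']
      exact Subgroup.mem_inf.2 ⟨commutator_mem_galFixing F σ τ, (MonoidHom.mem_ker).2 (sign_commutator_eq_one ε σ τ)⟩
    rw [MonoidHom.mem_ker, map_mul, map_mul, map_mul, map_inv, map_inv, mul_inv_eq_one, mul_inv_eq_iff_eq_mul] at hmem
    exact hmem
  haveI : IsMulCommutative (F' ≃ₐ[K] F') := ⟨⟨hcomm⟩⟩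
  haveI hab : IsAbelianGalois K F' := IsAbelianGalois.mk
  -- `F ≤ F′`
  have hle : F ≤ F' := by
    have h1 : F'.fixingSubgroup ≤ F.fixingSubgroup := by
      intro σ hσ
      rw [IntermediateField.mem_fixingSubgroup_iff] at hσ ⊢
      have hσ' : ((absoluteGaloisGroup.toAlgEquiv K).symm σ) ∈ galFixing K F' :=
        (mem_galFixing_iff K).2 fun x hx ↦ hσ x hx
      rw [hF'] at hσ'
      exact fun x hx ↦ (mem_galFixing_iff K).1 (Subgroup.mem_inf.1 hσ').1 x hx
    have h2 := (IntermediateField.le_iff_le F'.fixingSubgroup F).mpr h1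
    rwa [InfiniteGalois.fixedField_fixingSubgroup] at h2
  exact ⟨F', hF', hle, hfin, hab, NumberField.of_module_finite K F', hF'normal⟩

end General

/-! ## §2. The instance for the layers of a `ℤ_p`-extension -/

section Layers

variable {K : Type} [Field K] [NumberField K] {p : ℕ} [Fact p.Prime] (κ : Literature.NumberTheory.EllipticCurves.ZpExtension K p)

/-- **THE TWISTED LAYER FIELD OF `K_n`.** For the `n`-th layer `K_n = κ.layer n` of a `ℤ_p`-extension of a number field `K` (abelian:
cyclic of degree `p^n`) and `ε : Γ_K →* ℤˣ` with open kernel there is `F′ ⊆ K̄` with `Gal(K̄/F′) = κ.layerSubgroup n ∩ ker ε`, `K_n ⊆ F′`,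
finite ABELIAN Galois over `K`, a number field, with `Gal(K̄/F′) ⊴ Γ_K` — the `F′` of p704411 / p705557 for `F = K_n`.
[cite: Washington1997, §13.1] [cite: NeukirchANT1999, Ch. IV §1] -/
theorem exists_twistedLayerField (n : ℕ) (ε : absoluteGaloisGroup K →* ℤˣ) (hε : IsOpen (ε.ker : Set (absoluteGaloisGroup K))) :
    ∃ F' : IntermediateField K (AlgebraicClosure K),
      galFixing K F' = κ.layerSubgroup n ⊓ ε.ker ∧ κ.layer n ≤ F' ∧ FiniteDimensional K F' ∧ IsAbelianGalois K F' ∧ NumberField F' ∧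
        (galFixing K F').Normal := by
  haveI : FiniteDimensional K (κ.layer n) := κ.finiteDimensional_layer_holds n
  haveI : IsAbelianGalois K (κ.layer n) := κ.isAbelianGalois_layer n
  obtain ⟨F', hF', h⟩ := exists_intermediateField_galFixing_eq_inf_ker (κ.layer n) ε hε
  rw [Literature.NumberTheory.GaloisCohomology.galFixing_layer K κ n] at hF'
  exact ⟨F', hF', h⟩

end Layers

end Summit.BirchSwinnertonDyer.BirchSwinnertonDyer.Theorems.PrintCf2.KummerUDict

end
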